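import Literature.NumberTheory.Transcendental.SemialgebraicMonotonicityDefinable
import HarnessLib

/-!
# Monotonicity theorem for semialgebraic functions — II: the proof

Discharge `semialgebraic_monotonicity_holds` of the named fact
`Literature.NumberTheory.Transcendental.semialgebraic_monotonicity` (van den Dries 1998, Ch. 3
(1.2) MONOTONICITY THEOREM, for functions `f : ℝ → ℝ` whose graph over a bounded interval `(a, b)`
is `ℚ`-semialgebraic): there is a finite set of breakpoints in `(a, b)` off which, on each
complementary open interval, `f` is constant, or strictly monotone and continuous.

## The proof (van den Dries 1998, Ch. 3 §1, specialised to the real line)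

We work in the o-minimal structure of real semialgebraic sets (file
`SemialgebraicMonotonicityDefinable.lean`: definability kit, and o-minimality of the line in the
form "a definable `A ⊆ ℝ` has constant one-sided germs at every point and is finite unless it
contains an interval"). As in the printed proof of Lemma 2 (Ch. 3 (1.5)), o-minimality applied to
the definable sets `{y > x | f y < f x}`, `{y > x | f y = f x}`, `{y > x | f y > f x}` gives every
`x ∈ (a, b)` a *right germ type* `<`, `=` or `>` (`germ_right`), and likewise a left germ type
(`germ_left`); the nine type-sets are definable (`sa_setOf_eventually_nhdsGT/LT`).

* **Good types** (EASY CASE of Lemma 2 and Cases 1–3 of (1.4), the `sup` argument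
  `s := sup {x | f is … on [x₀, x)}`, printed p. 44): if every point of an interval has type
  `(<, >)` then `f` is strictly increasing on it, `(>, <)` strictly decreasing, `(=, =)` constant
  (`forall_rel_of_eventually` and its three corollaries).
* **Bad types are finite.** A type with exactly one `=` side cannot hold on an interval
  (`not_Ioo_subset_eventuallyEq_right`, `…_left`: right of a point with right type `=` the left
  type is `=`). The types `(>, >)` / `(<, <)` (strict local minima / maxima — the DIFFICULT CASE
  `Φ₊₊`/`Φ₋₋` of Lemma 2) cannot hold on an interval either: **on the real line** the set of strict
  local extrema of any function is countable while intervals are not (`not_forall_isStrictLocalMin`).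
  This replaces the page-long order-theoretic argument of the printed DIFFICULT CASE; it is the
  "easy proof for o-minimal structures on the real line" alluded to in the Notes to Ch. 3 (p. 61,
  citing van den Dries 1984). By o-minimality each bad type-set, being definable without
  interior, is finite.
* **Continuity** (Lemma 3 as printed, (1.5): `f(I)` is definable and infinite, hence contains an
  interval, and a strictly monotone map of an interval onto an interval is continuous —
  `exists_continuousOn_of_strictMonoOn`); the definable set of discontinuity points therefore
  contains no interval inside a monotone piece, so it is finite.
* **Assembly** ((1.4)): the breakpoints are the bad-type points, the finite boundaries of the
  three good type-sets and the discontinuity points; every complementary interval lies in one good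
  type-set (`exists_finset_piecewise`), which gives the theorem (`semialgebraic_monotonicity_holds`).

Lemma 1 of the printed proof (constant or injective on a subinterval) is not needed in this
arrangement: the germ-type analysis is applied to `f` directly rather than to an injective
restriction.

## References

* [Dries1998] L. van den Dries, *Tame Topology and O-minimal Structures*, CUP 1998, Ch. 3 §1,
  (1.2) Monotonicity Theorem, (1.4)–(1.5) its proof, and Notes p. 61.
* L. van den Dries, *Remarks on Tarski's problem concerning (ℝ, +, ·, exp)*, Logic Colloquium '82,
  North-Holland 1984, 97–121 (the real-line proof).
-/

open Set Filter Topology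
open Literature.ModelTheory.ExponentialFields

namespace Literature.NumberTheory.Transcendental

namespace SemialgebraicMonotonicity

/-! ### Real analysis of one-sided germ types (no definability) -/

section Analysis

variable {f : ℝ → ℝ} {p q : ℝ}

/-- **From local to global through a transitive relation** (van den Dries 1998, Ch. 3 (1.4)
Cases 1–3 and (1.5) EASY CASE: "`s(x) := sup {s ∈ (x, b) : f > f(x) on (x, s]}`, then `s(x) = b`"):
if at every point `x` of `(p, q)` we have `r (f y) (f x)` for `y` slightly left of `x` and
`r (f x) (f y)` for `y` slightly right of `x`, with `r` transitive, then `r (f x) (f y)` for all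
`x < y` in `(p, q)`. On `ℝ` the supremum exists by completeness (in a general o-minimal structure
by definability). [cite: Dries1998, Ch. 3 (1.4)–(1.5)] -/
theorem forall_rel_of_eventually {r : ℝ → ℝ → Prop}
    (htrans : ∀ u v w, r u v → r v w → r u w)
    (h : ∀ x ∈ Ioo p q, (∀ᶠ y in 𝓝[<] x, r (f y) (f x)) ∧ (∀ᶠ y in 𝓝[>] x, r (f x) (f y))) :
    ∀ x ∈ Ioo p q, ∀ y ∈ Ioo p q, x < y → r (f x) (f y) := by
  intro x hx
  set S : Set ℝ := {s | s ∈ Ioc x q ∧ ∀ y ∈ Ioo x s, r (f x) (f y)} with hS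
  obtain ⟨c, hxc, hc⟩ := mem_nhdsGT_iff_exists_Ioo_subset.1 (h x hx).2
  have hs₀ : min c q ∈ S :=
    ⟨⟨lt_min hxc hx.2, min_le_right _ _⟩,
      fun y hy => hc ⟨hy.1, hy.2.trans_le (min_le_left _ _)⟩⟩
  have hne : S.Nonempty := ⟨_, hs₀⟩
  have hbdd : BddAbove S := ⟨q, fun s hs => hs.1.2⟩
  have hxσ : x < sSup S := (lt_min hxc hx.2).trans_le (le_csSup hbdd hs₀)
  have hσq : sSup S ≤ q := csSup_le hne fun s hs => hs.1.2
  -- `(x, sup S)` is good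
  have hgood : ∀ y ∈ Ioo x (sSup S), r (f x) (f y) := by
    intro y hy
    obtain ⟨s, hs, hys⟩ := exists_lt_of_lt_csSup hne hy.2
    exact hs.2 y ⟨hy.1, hys⟩
  -- hence `sup S = q`
  have hσ : sSup S = q := by
    by_contra hne'
    have hσq' : sSup S < q := lt_of_le_of_ne hσq hne'
    have hσI : sSup S ∈ Ioo p q := ⟨hx.1.trans hxσ, hσq'⟩
    obtain ⟨c₁, hc₁, h₁⟩ := mem_nhdsLT_iff_exists_Ioo_subset.1 (h _ hσI).1
    obtain ⟨c₂, hc₂, h₂⟩ := mem_nhdsGT_iff_exists_Ioo_subset.1 (h _ hσI).2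
    obtain ⟨y₀, hy₀, hy₀σ⟩ := exists_between (max_lt (mem_Iio.1 hc₁) hxσ)
    have hxσ' : r (f x) (f (sSup S)) :=
      htrans _ _ _ (hgood y₀ ⟨(le_max_right _ _).trans_lt hy₀, hy₀σ⟩)
        (h₁ ⟨(le_max_left _ _).trans_lt hy₀, hy₀σ⟩)
    have hs₁ : min c₂ q ∈ S := by
      refine ⟨⟨lt_min (hxσ.trans hc₂) hx.2, min_le_right _ _⟩, fun y hy => ?_⟩
      rcases lt_trichotomy y (sSup S) with hyσ | rfl | hyσ
      · exact hgood y ⟨hy.1, hyσ⟩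
      · exact hxσ'
      · exact htrans _ _ _ hxσ' (h₂ ⟨hyσ, hy.2.trans_le (min_le_left _ _)⟩)
    have hle : min c₂ q ≤ sSup S := le_csSup hbdd hs₁
    exact (not_le.2 (lt_min (mem_Ioi.1 hc₂) hσq')) hle
  intro y hy hxy
  exact hgood y ⟨hxy, lt_of_lt_of_eq hy.2 hσ.symm⟩

/-- If every point of `(p, q)` has germ type `(<, >)` — `f y < f x` slightly left of `x`,
`f x < f y` slightly right — then `f` is strictly increasing on `(p, q)` (van den Dries 1998,
Ch. 3 (1.5), EASY CASE `Φ₋₊`; (1.4) Case 2). [cite: Dries1998, Ch. 3 (1.4)–(1.5)] -/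
theorem strictMonoOn_of_eventually
    (h : ∀ x ∈ Ioo p q, (∀ᶠ y in 𝓝[<] x, f y < f x) ∧ (∀ᶠ y in 𝓝[>] x, f x < f y)) :
    StrictMonoOn f (Ioo p q) :=
  fun x hx y hy hxy =>
    forall_rel_of_eventually (r := (· < ·)) (fun _ _ _ => lt_trans) h x hx y hy hxy

/-- If every point of `(p, q)` has germ type `(>, <)` then `f` is strictly decreasing on `(p, q)`
(van den Dries 1998, Ch. 3 (1.5), the case `Φ₊₋`; (1.4) Case 3).
[cite: Dries1998, Ch. 3 (1.4)–(1.5)] -/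
theorem strictAntiOn_of_eventually
    (h : ∀ x ∈ Ioo p q, (∀ᶠ y in 𝓝[<] x, f x < f y) ∧ (∀ᶠ y in 𝓝[>] x, f y < f x)) :
    StrictAntiOn f (Ioo p q) :=
  fun x hx y hy hxy =>
    forall_rel_of_eventually (r := fun u v => v < u) (fun _ _ _ h1 h2 => lt_trans h2 h1)
      h x hx y hy hxy

/-- If every point of `(p, q)` has germ type `(=, =)` then `f` is constant on `(p, q)`
(van den Dries 1998, Ch. 3 (1.4) Case 1). [cite: Dries1998, Ch. 3 (1.4)] -/
theorem exists_eqOn_const_of_eventually (hpq : p < q)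
    (h : ∀ x ∈ Ioo p q, (∀ᶠ y in 𝓝[<] x, f y = f x) ∧ (∀ᶠ y in 𝓝[>] x, f y = f x)) :
    ∃ C, EqOn f (fun _ => C) (Ioo p q) := by
  have key := forall_rel_of_eventually (f := f) (r := (· = ·)) (fun _ _ _ => Eq.trans)
    fun x hx => ⟨(h x hx).1, (h x hx).2.mono fun y hy => hy.symm⟩
  have hm : (p + q) / 2 ∈ Ioo p q := ⟨by linarith, by linarith⟩
  refine ⟨f ((p + q) / 2), fun y hy => ?_⟩
  rcases lt_trichotomy y ((p + q) / 2) with hlt | heq | hgt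
  · exact key y hy _ hm hlt
  · rw [heq]
  · exact (key _ hm y hy hgt).symm

/-- **Strict local minima cannot fill an interval** (real-line replacement for the DIFFICULT CASE
`Φ₊₊` of van den Dries 1998, Ch. 3 (1.5), cf. Notes p. 61): there is no function on `ℝ` all of
whose points in a nondegenerate interval `(p, q)` are strict local minima. Indeed the points with a
witness radius `> 1/(n+1)` are `1/(n+1)`-separated, so strict local minima form a countable set,
while `(p, q)` is uncountable. [cite: Dries1998, Ch. 3 (1.5) and Notes to Ch. 3] -/
theorem not_forall_isStrictLocalMin (hpq : p < q)
    (h : ∀ x ∈ Ioo p q, ∀ᶠ y in 𝓝[≠] x, f x < f y) : False := by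
  have hT : ∀ x ∈ Ioo p q, ∃ n : ℕ, ∀ y, y ≠ x → |y - x| < 1 / ((n : ℝ) + 1) → f x < f y := by
    intro x hx
    have hx' := h x hx
    rw [eventually_nhdsWithin_iff, Metric.eventually_nhds_iff] at hx'
    obtain ⟨ε, hε, hε'⟩ := hx'
    obtain ⟨n, hn⟩ := exists_nat_one_div_lt hε
    refine ⟨n, fun y hyx hy => hε' ?_ hyx⟩
    rw [Real.dist_eq]
    exact hy.trans hn
  set T : ℕ → Set ℝ := fun n =>
    {x | x ∈ Ioo p q ∧ ∀ y, y ≠ x → |y - x| < 1 / ((n : ℝ) + 1) → f x < f y} with hTdef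
  have hcount : ∀ n, (T n).Countable := by
    intro n
    have hpos : (0 : ℝ) < (n : ℝ) + 1 := by positivity
    refine Set.MapsTo.countable_of_injOn (f := fun x : ℝ => ⌊x * ((n : ℝ) + 1)⌋)
      (Set.mapsTo_univ _ _) ?_ Set.countable_univ
    intro x hx x' hx' hfl
    by_contra hne
    have habs : |x * ((n : ℝ) + 1) - x' * ((n : ℝ) + 1)| < 1 :=
      Int.abs_sub_lt_one_of_floor_eq_floor hfl
    rw [← sub_mul, abs_mul, abs_of_pos hpos] at habs
    have hdist : |x - x'| < 1 / ((n : ℝ) + 1) := by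
      rw [lt_div_iff₀ hpos]
      exact habs
    have h1 : f x' < f x := hx'.2 x hne hdist
    rw [abs_sub_comm] at hdist
    have h2 : f x < f x' := hx.2 x' (Ne.symm hne) hdist
    exact lt_asymm h1 h2
  have hsub : Ioo p q ⊆ ⋃ n, T n := fun x hx => by
    obtain ⟨n, hn⟩ := hT x hx
    exact Set.mem_iUnion.2 ⟨n, hx, hn⟩
  have hc : (Ioo p q).Countable := (Set.countable_iUnion hcount).mono hsub
  have h1 := Cardinal.mk_Ioo_real hpq
  have h2 : Cardinal.mk (Ioo p q) ≤ Cardinal.aleph0 :=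
    Cardinal.mk_le_aleph0_iff.2 hc.to_subtype
  rw [h1] at h2
  exact Cardinal.aleph0_lt_continuum.not_ge h2

/-- Two one-sided germs make a punctured germ. [folklore] -/
theorem eventually_nhdsNE_of_LT_GT {x : ℝ} {P : ℝ → Prop}
    (h₁ : ∀ᶠ y in 𝓝[<] x, P y) (h₂ : ∀ᶠ y in 𝓝[>] x, P y) : ∀ᶠ y in 𝓝[≠] x, P y := by
  rw [← nhdsLT_sup_nhdsGT]
  exact Filter.eventually_sup.2 ⟨h₁, h₂⟩

/-- **A mixed germ type with right side `=` cannot fill an interval**: if right of `x` the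
function equals `f x`, then every point slightly right of `x` has left type `=`, not `<` or `>`
(the elementary part of sorting the nine germ types; van den Dries 1998, Ch. 3 (1.5)).
[cite: Dries1998, Ch. 3 (1.5)] -/
theorem not_Ioo_subset_eventuallyEq_right (hpq : p < q)
    (h : ∀ x ∈ Ioo p q, (∀ᶠ y in 𝓝[>] x, f y = f x) ∧
      ((∀ᶠ y in 𝓝[<] x, f y < f x) ∨ (∀ᶠ y in 𝓝[<] x, f x < f y))) : False := by
  have hm : (p + q) / 2 ∈ Ioo p q := ⟨by linarith, by linarith⟩
  obtain ⟨c, hmc, hc⟩ := mem_nhdsGT_iff_exists_Ioo_subset.1 (h _ hm).1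
  obtain ⟨y, hmy, hyc⟩ := exists_between (lt_min (mem_Ioi.1 hmc) hm.2)
  have hy : y ∈ Ioo p q := ⟨hm.1.trans hmy, hyc.trans_le (min_le_right _ _)⟩
  have hyc' : y < c := hyc.trans_le (min_le_left _ _)
  have hfy : f y = f ((p + q) / 2) := hc ⟨hmy, hyc'⟩
  have heq : ∀ᶠ z in 𝓝[<] y, f z = f y :=
    mem_nhdsLT_iff_exists_Ioo_subset.2 ⟨(p + q) / 2, hmy, fun z hz =>
      (hc ⟨hz.1, hz.2.trans hyc'⟩).trans hfy.symm⟩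
  rcases (h y hy).2 with hlt | hgt
  · obtain ⟨z, hz1, hz2⟩ := (heq.and hlt).exists
    exact hz2.ne hz1
  · obtain ⟨z, hz1, hz2⟩ := (heq.and hgt).exists
    exact hz2.ne hz1.symm

/-- **A mixed germ type with left side `=` cannot fill an interval** (mirror image of
`not_Ioo_subset_eventuallyEq_right`). [cite: Dries1998, Ch. 3 (1.5)] -/
theorem not_Ioo_subset_eventuallyEq_left (hpq : p < q)
    (h : ∀ x ∈ Ioo p q, (∀ᶠ y in 𝓝[<] x, f y = f x) ∧
      ((∀ᶠ y in 𝓝[>] x, f y < f x) ∨ (∀ᶠ y in 𝓝[>] x, f x < f y))) : False := by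
  have hm : (p + q) / 2 ∈ Ioo p q := ⟨by linarith, by linarith⟩
  obtain ⟨c, hcm, hc⟩ := mem_nhdsLT_iff_exists_Ioo_subset.1 (h _ hm).1
  obtain ⟨y, hcy, hym⟩ := exists_between (max_lt (mem_Iio.1 hcm) hm.1)
  have hy : y ∈ Ioo p q := ⟨(le_max_right _ _).trans_lt hcy, hym.trans hm.2⟩
  have hcy' : c < y := (le_max_left _ _).trans_lt hcy
  have hfy : f y = f ((p + q) / 2) := hc ⟨hcy', hym⟩
  have heq : ∀ᶠ z in 𝓝[>] y, f z = f y :=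
    mem_nhdsGT_iff_exists_Ioo_subset.2 ⟨(p + q) / 2, hym, fun z hz =>
      (hc ⟨hcy'.trans hz.1, hz.2⟩).trans hfy.symm⟩
  rcases (h y hy).2 with hlt | hgt
  · obtain ⟨z, hz1, hz2⟩ := (heq.and hlt).exists
    exact hz2.ne hz1
  · obtain ⟨z, hz1, hz2⟩ := (heq.and hgt).exists
    exact hz2.ne hz1.symm

end Analysis

/-! ### Germ types of a function with semialgebraic graph -/

section Germs

variable {f : ℝ → ℝ} {a b : ℝ}

/-- **Right germ trichotomy** (van den Dries 1998, Ch. 3 (1.5), proof of Lemma 2: "the interval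
`(x, b)` breaks up similarly, … so one of the parts contains an interval"): at every `x ∈ (a, b)`,
eventually right of `x` we have `f y < f x`, or `f y = f x`, or `f y > f x` — by o-minimality of the
three definable sets `{y ∈ (a, b) | f y ⋚ f x}`. [cite: Dries1998, Ch. 3 (1.5)] -/
theorem germ_right (hG : IsSemialgebraic ℝ {w : Fin 2 → ℝ | w 0 ∈ Ioo a b ∧ w 1 = f (w 0)})
    {x : ℝ} (hx : x ∈ Ioo a b) :
    (∀ᶠ y in 𝓝[>] x, f y < f x) ∨ (∀ᶠ y in 𝓝[>] x, f y = f x) ∨ (∀ᶠ y in 𝓝[>] x, f x < f y) := by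
  have hdom : ∀ᶠ y in 𝓝[>] x, y ∈ Ioo a b :=
    Filter.mem_of_superset (Ioo_mem_nhdsGT hx.2) fun y hy => ⟨hx.1.trans hy.1, hy.2⟩
  have A1 : IsSemialgebraic ℝ {z : Fin 1 → ℝ | z 0 ∈ {y | y ∈ Ioo a b ∧ f y < f x}} :=
    sa_fval hG (r := fun u => u < f x) (fun m i => sa_lt_const i (f x)) 0
  have A2 : IsSemialgebraic ℝ {z : Fin 1 → ℝ | z 0 ∈ {y | y ∈ Ioo a b ∧ f y = f x}} :=
    sa_fval hG (r := fun u => u = f x) (fun m i => sa_eq_const i (f x)) 0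
  have A3 : IsSemialgebraic ℝ {z : Fin 1 → ℝ | z 0 ∈ {y | y ∈ Ioo a b ∧ f x < f y}} :=
    sa_fval hG (r := fun u => f x < u) (fun m i => sa_const_lt i (f x)) 0
  rcases eventually_nhdsGT_mem_or A1 x with h1 | h1
  · exact Or.inl (h1.mono fun y hy => hy.2)
  rcases eventually_nhdsGT_mem_or A2 x with h2 | h2
  · exact Or.inr (Or.inl (h2.mono fun y hy => hy.2))
  rcases eventually_nhdsGT_mem_or A3 x with h3 | h3
  · exact Or.inr (Or.inr (h3.mono fun y hy => hy.2))
  exfalso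
  obtain ⟨y, hy, hy1, hy2, hy3⟩ := (hdom.and (h1.and (h2.and h3))).exists
  rcases lt_trichotomy (f y) (f x) with hlt | heq | hgt
  · exact hy1 ⟨hy, hlt⟩
  · exact hy2 ⟨hy, heq⟩
  · exact hy3 ⟨hy, hgt⟩

/-- **Left germ trichotomy** (van den Dries 1998, Ch. 3 (1.5): "`(a, x)` is a disjoint union of
two [here three] definable subsets, so one of the parts contains an interval `(c, x)`").
[cite: Dries1998, Ch. 3 (1.5)] -/
theorem germ_left (hG : IsSemialgebraic ℝ {w : Fin 2 → ℝ | w 0 ∈ Ioo a b ∧ w 1 = f (w 0)})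
    {x : ℝ} (hx : x ∈ Ioo a b) :
    (∀ᶠ y in 𝓝[<] x, f y < f x) ∨ (∀ᶠ y in 𝓝[<] x, f y = f x) ∨ (∀ᶠ y in 𝓝[<] x, f x < f y) := by
  have hdom : ∀ᶠ y in 𝓝[<] x, y ∈ Ioo a b :=
    Filter.mem_of_superset (Ioo_mem_nhdsLT hx.1) fun y hy => ⟨hy.1, hy.2.trans hx.2⟩
  have A1 : IsSemialgebraic ℝ {z : Fin 1 → ℝ | z 0 ∈ {y | y ∈ Ioo a b ∧ f y < f x}} :=
    sa_fval hG (r := fun u => u < f x) (fun m i => sa_lt_const i (f x)) 0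
  have A2 : IsSemialgebraic ℝ {z : Fin 1 → ℝ | z 0 ∈ {y | y ∈ Ioo a b ∧ f y = f x}} :=
    sa_fval hG (r := fun u => u = f x) (fun m i => sa_eq_const i (f x)) 0
  have A3 : IsSemialgebraic ℝ {z : Fin 1 → ℝ | z 0 ∈ {y | y ∈ Ioo a b ∧ f x < f y}} :=
    sa_fval hG (r := fun u => f x < u) (fun m i => sa_const_lt i (f x)) 0
  rcases eventually_nhdsLT_mem_or A1 x with h1 | h1
  · exact Or.inl (h1.mono fun y hy => hy.2)
  rcases eventually_nhdsLT_mem_or A2 x with h2 | h2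
  · exact Or.inr (Or.inl (h2.mono fun y hy => hy.2))
  rcases eventually_nhdsLT_mem_or A3 x with h3 | h3
  · exact Or.inr (Or.inr (h3.mono fun y hy => hy.2))
  exfalso
  obtain ⟨y, hy, hy1, hy2, hy3⟩ := (hdom.and (h1.and (h2.and h3))).exists
  rcases lt_trichotomy (f y) (f x) with hlt | heq | hgt
  · exact hy1 ⟨hy, hlt⟩
  · exact hy2 ⟨hy, heq⟩
  · exact hy3 ⟨hy, hgt⟩

/-- **Lemma 3** (van den Dries 1998, Ch. 3 (1.3)/(1.5)): a strictly increasing function with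
semialgebraic graph is continuous on a subinterval. Printed proof: `f(I)` is (definable and)
infinite, so contains an interval `J`; for `r < s` in `J` with preimages `c < d`, `f` is an
order-preserving bijection of `(c, d)` onto `(r, s)`, hence continuous there.
[cite: Dries1998, Ch. 3 (1.5) Lemma 3] -/
theorem exists_continuousOn_of_strictMonoOn
    (hG : IsSemialgebraic ℝ {w : Fin 2 → ℝ | w 0 ∈ Ioo a b ∧ w 1 = f (w 0)})
    {p q : ℝ} (hpq : p < q) (hsub : Ioo p q ⊆ Ioo a b) (hmono : StrictMonoOn f (Ioo p q)) :
    ∃ c d, p ≤ c ∧ c < d ∧ d ≤ q ∧ ContinuousOn f (Ioo c d) := by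
  have hV := sa_image_Ioo hG hsub
  have hinf : (f '' Ioo p q).Infinite := (Set.Ioo_infinite hpq).image hmono.injOn
  obtain ⟨r₁, s₁, hrs₁, hI⟩ := exists_Ioo_subset_of_infinite hV hinf
  obtain ⟨r, hr₁, hrs⟩ := exists_between hrs₁
  obtain ⟨s, hrs', hss₁⟩ := exists_between hrs
  obtain ⟨c, hc, hfc⟩ := hI ⟨hr₁, hrs⟩
  obtain ⟨d, hd, hfd⟩ := hI ⟨hr₁.trans hrs', hss₁⟩
  subst hfc hfd
  have hcd : c < d := (hmono.lt_iff_lt hc hd).1 hrs'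
  have hIcd : Ioo c d ⊆ Ioo p q := fun y hy => ⟨hc.1.trans hy.1, hy.2.trans hd.2⟩
  have himage : f '' Ioo c d = Ioo (f c) (f d) := by
    apply Subset.antisymm
    · rintro _ ⟨y, hy, rfl⟩
      exact ⟨hmono hc (hIcd hy) hy.1, hmono (hIcd hy) hd hy.2⟩
    · intro v hv
      obtain ⟨e, he, rfl⟩ := hI ⟨hr₁.trans hv.1, hv.2.trans hss₁⟩
      exact ⟨e, ⟨(hmono.lt_iff_lt hc he).1 hv.1, (hmono.lt_iff_lt he hd).1 hv.2⟩, rfl⟩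
  refine ⟨c, d, hc.1.le, hcd, hd.2.le, fun x hx => ContinuousAt.continuousWithinAt ?_⟩
  refine continuousAt_of_monotoneOn_of_image_mem_nhds (hmono.mono hIcd).monotoneOn
    (Ioo_mem_nhds hx.1 hx.2) ?_
  rw [himage]
  exact Ioo_mem_nhds (hmono hc (hIcd hx) hx.1) (hmono (hIcd hx) hd hx.2)

/-- **Lemma 3, decreasing case** (van den Dries 1998, Ch. 3 (1.5): "the case that `f` is strictly
decreasing goes the same way"): apply the increasing case to `-f`.
[cite: Dries1998, Ch. 3 (1.5) Lemma 3] -/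
theorem exists_continuousOn_of_strictAntiOn
    (hG : IsSemialgebraic ℝ {w : Fin 2 → ℝ | w 0 ∈ Ioo a b ∧ w 1 = f (w 0)})
    {p q : ℝ} (hpq : p < q) (hsub : Ioo p q ⊆ Ioo a b) (hanti : StrictAntiOn f (Ioo p q)) :
    ∃ c d, p ≤ c ∧ c < d ∧ d ≤ q ∧ ContinuousOn f (Ioo c d) := by
  obtain ⟨c, d, h1, h2, h3, hcont⟩ := exists_continuousOn_of_strictMonoOn (f := fun x => -f x)
    (sa_graph_neg hG) hpq hsub hanti.neg
  exact ⟨c, d, h1, h2, h3, hcont.neg.congr fun x _ => (neg_neg (f x)).symm⟩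

end Germs

/-! ### Assembly -/

section Assembly

variable {f : ℝ → ℝ} {a b : ℝ}

/-- **The monotonicity theorem in finite-boundary form** (van den Dries 1998, Ch. 3 (1.2) with the
assembly (1.4)): for `f` with real-semialgebraic graph over `(a, b)` there is a finite `s ⊆ (a, b)`
such that on every subinterval `(p, q) ⊆ (a, b)` containing no point of `s`, `f` is constant, or
strictly monotone and continuous. The set `s` consists of the (finitely many) points of bad germ
type, the finite boundaries of the three good germ-type sets, and the (finitely many)
discontinuity points. [cite: Dries1998, Ch. 3 (1.2) and (1.4)] -/
theorem exists_finset_piecewise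
    (hG : IsSemialgebraic ℝ {w : Fin 2 → ℝ | w 0 ∈ Ioo a b ∧ w 1 = f (w 0)}) :
    ∃ s : Finset ℝ, (↑s : Set ℝ) ⊆ Ioo a b ∧
      ∀ p q : ℝ, p < q → Ioo p q ⊆ Ioo a b → (∀ x ∈ s, x ∉ Ioo p q) →
        (∃ C : ℝ, EqOn f (fun _ => C) (Ioo p q)) ∨
          ((StrictMonoOn f (Ioo p q) ∨ StrictAntiOn f (Ioo p q)) ∧ ContinuousOn f (Ioo p q)) := by
  classical
  -- the six one-sided germ-type sets
  set RL : Set ℝ := {x | x ∈ Ioo a b ∧ ∀ᶠ y in 𝓝[>] x, f y < f x} with hRL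
  set RE : Set ℝ := {x | x ∈ Ioo a b ∧ ∀ᶠ y in 𝓝[>] x, f y = f x} with hRE
  set RG : Set ℝ := {x | x ∈ Ioo a b ∧ ∀ᶠ y in 𝓝[>] x, f x < f y} with hRG
  set LL : Set ℝ := {x | x ∈ Ioo a b ∧ ∀ᶠ y in 𝓝[<] x, f y < f x} with hLL
  set LE : Set ℝ := {x | x ∈ Ioo a b ∧ ∀ᶠ y in 𝓝[<] x, f y = f x} with hLE
  set LG : Set ℝ := {x | x ∈ Ioo a b ∧ ∀ᶠ y in 𝓝[<] x, f x < f y} with hLG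
  have dRL : IsSemialgebraic ℝ {z : Fin 1 → ℝ | z 0 ∈ RL} :=
    sa_setOf_eventually_nhdsGT hG (r := (· < ·)) fun m i j => sa_lt i j
  have dRE : IsSemialgebraic ℝ {z : Fin 1 → ℝ | z 0 ∈ RE} :=
    sa_setOf_eventually_nhdsGT hG (r := (· = ·)) fun m i j => sa_eq i j
  have dRG : IsSemialgebraic ℝ {z : Fin 1 → ℝ | z 0 ∈ RG} :=
    sa_setOf_eventually_nhdsGT hG (r := fun u v => v < u) fun m i j => sa_lt j i
  have dLL : IsSemialgebraic ℝ {z : Fin 1 → ℝ | z 0 ∈ LL} :=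
    sa_setOf_eventually_nhdsLT hG (r := (· < ·)) fun m i j => sa_lt i j
  have dLE : IsSemialgebraic ℝ {z : Fin 1 → ℝ | z 0 ∈ LE} :=
    sa_setOf_eventually_nhdsLT hG (r := (· = ·)) fun m i j => sa_eq i j
  have dLG : IsSemialgebraic ℝ {z : Fin 1 → ℝ | z 0 ∈ LG} :=
    sa_setOf_eventually_nhdsLT hG (r := fun u v => v < u) fun m i j => sa_lt j i
  -- the four bad sets are finite
  have hBmin : (LG ∩ RG).Finite := by
    refine finite_of_forall_not_Ioo_subset (sa_and dLG dRG) fun p q hpq hsub => ?_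
    exact not_forall_isStrictLocalMin hpq fun x hx =>
      eventually_nhdsNE_of_LT_GT (hsub hx).1.2 (hsub hx).2.2
  have hBmax : (LL ∩ RL).Finite := by
    refine finite_of_forall_not_Ioo_subset (sa_and dLL dRL) fun p q hpq hsub => ?_
    refine not_forall_isStrictLocalMin (f := fun x => -f x) hpq fun x hx => ?_
    exact eventually_nhdsNE_of_LT_GT ((hsub hx).1.2.mono fun y hy => neg_lt_neg hy)
      ((hsub hx).2.2.mono fun y hy => neg_lt_neg hy)
  have hB₁ : (RE ∩ (LL ∪ LG)).Finite := by
    refine finite_of_forall_not_Ioo_subset (sa_and dRE (sa_or dLL dLG)) fun p q hpq hsub => ?_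
    refine not_Ioo_subset_eventuallyEq_right hpq fun x hx => ⟨(hsub hx).1.2, ?_⟩
    rcases (hsub hx).2 with h | h
    · exact Or.inl h.2
    · exact Or.inr h.2
  have hB₂ : (LE ∩ (RL ∪ RG)).Finite := by
    refine finite_of_forall_not_Ioo_subset (sa_and dLE (sa_or dRL dRG)) fun p q hpq hsub => ?_
    refine not_Ioo_subset_eventuallyEq_left hpq fun x hx => ⟨(hsub hx).1.2, ?_⟩
    rcases (hsub hx).2 with h | h
    · exact Or.inl h.2
    · exact Or.inr h.2
  -- finite boundaries of the three good sets
  obtain ⟨Fc, hFc⟩ := exists_finset_Ioo_subset_or_disjoint (A := LE ∩ RE) (sa_and dLE dRE)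
  obtain ⟨Fi, hFi⟩ := exists_finset_Ioo_subset_or_disjoint (A := LL ∩ RG) (sa_and dLL dRG)
  obtain ⟨Fd, hFd⟩ := exists_finset_Ioo_subset_or_disjoint (A := LG ∩ RL) (sa_and dLG dRL)
  set E₀ : Finset ℝ := hBmin.toFinset ∪ hBmax.toFinset ∪ hB₁.toFinset ∪ hB₂.toFinset ∪
    Fc ∪ Fi ∪ Fd with hE₀
  -- on an interval avoiding `E₀`, `f` is constant or strictly monotone
  have good : ∀ p q : ℝ, p < q → Ioo p q ⊆ Ioo a b → (∀ x ∈ E₀, x ∉ Ioo p q) →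
      (∃ C : ℝ, EqOn f (fun _ => C) (Ioo p q)) ∨
        StrictMonoOn f (Ioo p q) ∨ StrictAntiOn f (Ioo p q) := by
    intro p q hpq hsub hav
    have hm : (p + q) / 2 ∈ Ioo p q := ⟨by linarith, by linarith⟩
    have hmab : (p + q) / 2 ∈ Ioo a b := hsub hm
    have memE : ∀ {x}, x ∈ Ioo p q → x ∈ E₀ → False := fun hx hxE => hav _ hxE hx
    have hE : ∀ x, x ∈ E₀ ↔ x ∈ hBmin.toFinset ∨ x ∈ hBmax.toFinset ∨ x ∈ hB₁.toFinset ∨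
        x ∈ hB₂.toFinset ∨ x ∈ Fc ∨ x ∈ Fi ∨ x ∈ Fd := by
      intro x
      simp only [hE₀, Finset.mem_union, or_assoc]
    rcases germ_left hG hmab with hl | hl | hl <;> rcases germ_right hG hmab with hr | hr | hr
    · -- (<, <): strict local max
      exact (memE hm ((hE _).2 (Or.inr (Or.inl (hBmax.mem_toFinset.2
        ⟨⟨hmab, hl⟩, ⟨hmab, hr⟩⟩))))).elim
    · -- (<, =)
      exact (memE hm ((hE _).2 (Or.inr (Or.inr (Or.inl (hB₁.mem_toFinset.2
        ⟨⟨hmab, hr⟩, Or.inl ⟨hmab, hl⟩⟩)))))).elim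
    · -- (<, >): increasing
      rcases hFi p q (fun x hx hxI => memE hxI ((hE _).2
        (Or.inr (Or.inr (Or.inr (Or.inr (Or.inr (Or.inl hx)))))))) with h | h
      · exact Or.inr (Or.inl (strictMonoOn_of_eventually fun x hx => ⟨(h hx).1.2, (h hx).2.2⟩))
      · exact (Set.disjoint_left.1 h hm ⟨⟨hmab, hl⟩, ⟨hmab, hr⟩⟩).elim
    · -- (=, <)
      exact (memE hm ((hE _).2 (Or.inr (Or.inr (Or.inr (Or.inl (hB₂.mem_toFinset.2
        ⟨⟨hmab, hl⟩, Or.inl ⟨hmab, hr⟩⟩))))))).elim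
    · -- (=, =): constant
      rcases hFc p q (fun x hx hxI => memE hxI ((hE _).2
        (Or.inr (Or.inr (Or.inr (Or.inr (Or.inl hx))))))) with h | h
      · exact Or.inl (exists_eqOn_const_of_eventually hpq fun x hx => ⟨(h hx).1.2, (h hx).2.2⟩)
      · exact (Set.disjoint_left.1 h hm ⟨⟨hmab, hl⟩, ⟨hmab, hr⟩⟩).elim
    · -- (=, >)
      exact (memE hm ((hE _).2 (Or.inr (Or.inr (Or.inr (Or.inl (hB₂.mem_toFinset.2
        ⟨⟨hmab, hl⟩, Or.inr ⟨hmab, hr⟩⟩))))))).elim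
    · -- (>, <): decreasing
      rcases hFd p q (fun x hx hxI => memE hxI ((hE _).2
        (Or.inr (Or.inr (Or.inr (Or.inr (Or.inr (Or.inr hx)))))))) with h | h
      · exact Or.inr (Or.inr (strictAntiOn_of_eventually fun x hx => ⟨(h hx).1.2, (h hx).2.2⟩))
      · exact (Set.disjoint_left.1 h hm ⟨⟨hmab, hl⟩, ⟨hmab, hr⟩⟩).elim
    · -- (>, =)
      exact (memE hm ((hE _).2 (Or.inr (Or.inr (Or.inl (hB₁.mem_toFinset.2
        ⟨⟨hmab, hr⟩, Or.inr ⟨hmab, hl⟩⟩)))))).elim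
    · -- (>, >): strict local min
      exact (memE hm ((hE _).2 (Or.inl (hBmin.mem_toFinset.2
        ⟨⟨hmab, hl⟩, ⟨hmab, hr⟩⟩)))).elim
  -- the discontinuity set is finite
  have hD : ({x | x ∈ Ioo a b ∧ ¬ ContinuousAt f x}).Finite := by
    refine finite_of_forall_not_Ioo_subset (sa_setOf_not_continuousAt hG) fun p q hpq hsubD => ?_
    have hsub : Ioo p q ⊆ Ioo a b := fun x hx => (hsubD hx).1
    -- shrink `(p, q)` to avoid `E₀`
    obtain ⟨x, hxI, hxE⟩ := ((Set.Ioo_infinite hpq).sdiff E₀.finite_toSet).nonempty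
    obtain ⟨p', q', hp'x, hxq', hav'⟩ := exists_Ioo_forall_notMem_of_notMem E₀ hxE
    have hpq'' : max p p' < min q q' := (max_lt hxI.1 hp'x).trans (lt_min hxI.2 hxq')
    have hI'' : Ioo (max p p') (min q q') ⊆ Ioo p q := fun y hy =>
      ⟨(le_max_left _ _).trans_lt hy.1, hy.2.trans_le (min_le_left _ _)⟩
    have hav'' : ∀ z ∈ E₀, z ∉ Ioo (max p p') (min q q') := fun z hz hzI =>
      hav' z hz ⟨(le_max_right _ _).trans_lt hzI.1, hzI.2.trans_le (min_le_right _ _)⟩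
    have notD : ∀ y ∈ Ioo (max p p') (min q q'), ¬ ContinuousAt f y := fun y hy =>
      (hsubD (hI'' hy)).2
    rcases good _ _ hpq'' (hI''.trans hsub) hav'' with ⟨C, hC⟩ | hmono | hanti
    · have hm : (max p p' + min q q') / 2 ∈ Ioo (max p p') (min q q') :=
        ⟨by linarith, by linarith⟩
      refine notD _ hm ((continuousAt_const (y := C)).congr ?_)
      exact (Filter.eventuallyEq_of_mem (Ioo_mem_nhds hm.1 hm.2) hC).symm
    · obtain ⟨c, d, hc, hcd, hd, hcont⟩ :=
        exists_continuousOn_of_strictMonoOn hG hpq'' (hI''.trans hsub) hmono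
      have hm : (c + d) / 2 ∈ Ioo c d := ⟨by linarith, by linarith⟩
      exact notD _ ⟨hc.trans_lt hm.1, hm.2.trans_le hd⟩
        (hcont.continuousAt (Ioo_mem_nhds hm.1 hm.2))
    · obtain ⟨c, d, hc, hcd, hd, hcont⟩ :=
        exists_continuousOn_of_strictAntiOn hG hpq'' (hI''.trans hsub) hanti
      have hm : (c + d) / 2 ∈ Ioo c d := ⟨by linarith, by linarith⟩
      exact notD _ ⟨hc.trans_lt hm.1, hm.2.trans_le hd⟩
        (hcont.continuousAt (Ioo_mem_nhds hm.1 hm.2))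
  -- the breakpoints
  refine ⟨(E₀ ∪ hD.toFinset).filter (fun x => x ∈ Ioo a b), fun x hx => ?_, ?_⟩
  · exact (Finset.mem_filter.1 hx).2
  intro p q hpq hsub hav
  have havE : ∀ x ∈ E₀, x ∉ Ioo p q := fun x hx hxI =>
    hav x (Finset.mem_filter.2 ⟨Finset.mem_union_left _ hx, hsub hxI⟩) hxI
  have hcont : ContinuousOn f (Ioo p q) := by
    intro y hy
    refine ContinuousAt.continuousWithinAt ?_
    by_contra hy'
    exact hav y (Finset.mem_filter.2
      ⟨Finset.mem_union_right _ (hD.mem_toFinset.2 ⟨hsub hy, hy'⟩), hsub hy⟩) hy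
  rcases good p q hpq hsub havE with h | h | h
  · exact Or.inl h
  · exact Or.inr ⟨Or.inl h, hcont⟩
  · exact Or.inr ⟨Or.inr h, hcont⟩

end Assembly

end SemialgebraicMonotonicity

/-- **Discharge of the named fact `semialgebraic_monotonicity`** — the MONOTONICITY THEOREM of
van den Dries 1998, Ch. 3 (1.2), for functions `f : ℝ → ℝ` whose graph over the bounded interval
`(a, b)` is `ℚ`-semialgebraic: there is a finite set `s ⊆ (a, b)` of breakpoints such that on each
complementary open interval `f` is constant, or strictly monotone and continuous. Proof: the
`ℚ`-semialgebraic graph is `ℝ`-semialgebraic, and `SemialgebraicMonotonicity.exists_finset_piecewise`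
(the theorem in the o-minimal structure of real semialgebraic sets, following Ch. 3 §1) applies to
every complementary interval of its finite set. [cite: Dries1998, Ch. 3 (1.2) Monotonicity Theorem] -/
theorem semialgebraic_monotonicity_holds : semialgebraic_monotonicity := by
  intro a b f _ hf
  obtain ⟨s, hs, hmain⟩ :=
    SemialgebraicMonotonicity.exists_finset_piecewise
      (SemialgebraicMonotonicity.sa_graph_of_isSemialgebraicFunOn hf)
  refine ⟨s, hs, fun u v huv hu hv hav => hmain u v huv (fun x hx => ⟨?_, ?_⟩) hav⟩
  · rcases hu with rfl | hu
    · exact hx.1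
    · exact (hs hu).1.trans hx.1
  · rcases hv with rfl | hv
    · exact hx.2
    · exact hx.2.trans (hs hv).2

end Literature.NumberTheory.Transcendental
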